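import Summits.BirchSwinnertonDyer.Rank1Residual.X9.PrintCertTamagawa
import Literature.NumberTheory.QuadraticFields.KroneckerSplitting
import Literature.NumberTheory.EllipticCurves.HeegnerPoints
import Literature.NumberTheory.EllipticCurves.NonEisensteinPrimeOfSurjective
import HarnessLib

/-!
# Leaves X9 / X10b — per-pair certificate records: ROUTE-COMPATIBLE HEEGNER FRAMES and the HEEGNER-INDEX SCREEN (records v3, tool file)

HONEST FRAMING (cell `bsd-print-x9`, D-0131 (2) print tier; partition leaves `ClassX9` and `ClassX10 ∧ ¬Surj`):
theorems, one data structure and plumbing definitions; no named fact; nothing is asserted about any elliptic curve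
beyond what the kernel rechecks; no leaf is claimed closed (`BSDpOnClassX9`, `BSDpOnClassX10b` stay `@[conjecture]`;
cruxes J = item 20392 `HeegnerDivisibilityX9`, J₃ = item 21340 `HeegnerDivisibilityX10b` stay OPEN). Companion of
`X9/PrintCertSchema.lean` (the record), `X9/PrintCertBridge.lean` (`Record.intCurve`), `X9/PrintCertTamagawa.lean`
(kernel Tamagawa depth `t = ord_p ∏ c_ℓ`).

WHY. Both Heegner cruxes quantify over HEEGNER FRAMES of a pair `(E, p)`: an imaginary quadratic `K` with
`B < |d_K|`, every `q ∣ N_E` split in `K` (`SatisfiesHeegnerHypothesis (W.conductorNorm ℤ) K`), `p` split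
(`SatisfiesHeegnerHypothesis p K`), a square root `β` of `d_K` modulo `4N` (`(4 * N) ∣ β ^ 2 - d_K`) and — J₃ only,
rev 3b — `2` split (`NumberField.discr K % 8 = 1`); they ask `p^s ∣ P_n` for every depth `s ≤ t = ord_p ∏ c_ℓ(E)`.
At conductor `n = 1`, `P_1 = y_K ∈ E(K)` and the demand is `p^t ∣ y_K` in `E(K)`, i.e. `t ≤ v_p(m_K)` for the
Heegner index `m_K = [E(K)_{/tors} : ℤ y_K]` (rank `E(K) = 1`, `E(K)[p] = 0`). Gross–Zagier + BSD for `E/K` predict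
`#Ш(E/K) = (m_K / (c · ∏_{q ∣ N} c_q))²` (Jetchev 2008, Conj. 1.1 = Gross–Zagier 1986 V (2.2); `p ∤ c`, Rem. 1.2),
so `2 v_p(m_K) = 2t + v_p #Ш(E/K)` and `v_p(m_K) ≥ t`, with equality iff `Ш(E/K)[p] = 0`. This file carries, per
rank-`1` record, ONE route-compatible frame and the two-engine value of `m_K` — the J-SCREEN of PLAN v2.1 §2
(cell `bsd-print-x9`): the `n = 1` instance of J / J₃ on the first admissible frame, checked against the kernel `t`.

* `HeegnerCert` = the data: `d_K = D` (first fundamental discriminant, in increasing `|D|`, with the frame conditions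
  and `L(E^D, 1) ≠ 0`), `β`, a square root of `D` mod `p`, `h(D)`, the twist `E^D` (minimal model, conductor,
  `L(E^D,1)/Ω = num/den` EXACT, torsion, Tamagawa product, `#Ш_an(E^D)`), the index `m_K` and `v_p(m_K)`, `#E(K)_tors`,
  provenance.
* `Record.heegnerCheck r c` (decidable) RECHECKS: keys; `D < 0` fundamental, `|D| > 4` (`u_K = 1`); `D % 8 = 1` when
  `p = 3` (J₃'s rev-3b binder) or `2 ∣ N`; `gcd(D, N) = 1` and `4N ∣ β² − D` (the frame binder verbatim, `N` the
  record's conductor); at every listed bad prime `q` the splitting witness (`q = 2`: `D ≡ 1 (8)`; `q` odd: `q ∣ β² − D`,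
  `q ∤ D`); `p ∤ D`, `p ∣ r_p² − D` (`p` split); THE SCREEN `ord_p(tamagawa) ≤ v_p(m_K) = indexVal`; the GZ–BSD
  coherence `2·v_p(m_K) = 2·ord_p(tamagawa) + v_p(#Ш_an(E) · #Ш_an(E^D))` (odd `p`: `Ш(E/K)[p^∞] ≅ Ш(E)[p^∞] ⊕ Ш(E^D)[p^∞]`);
  BSD coherence of the twist `num · T² = #Ш_an(E^D) · ∏c(E^D) · den` (as `passInvariants` does for rank-`0` records).
* SOUNDNESS, for ANY number field `K` with `[K:ℚ] = 2` and `NumberField.discr K = c.D` and ANY globally minimal `W`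
  with the record's integral model (`hI`): `Record.satisfiesHeegnerHypothesis_of_heegnerCheck :
  SatisfiesHeegnerHypothesis (W.conductorNorm ℤ) K` (every `q ∣ N(W)` is bad, hence listed, hence split by the
  decomposition law `Quadratic.ncard_primesOver_eq_two_iff_legendreSym` / `…_two_eq_two_iff`);
  `Record.satisfiesHeegnerHypothesis_prime_of_heegnerCheck : SatisfiesHeegnerHypothesis p K`;
  `Record.discr_mod_eight_of_heegnerCheck` (`p = 3`); `Record.dvd_beta_sq_sub_discr_of_heegnerCheck :
  (4 * (r.conductor : ℤ)) ∣ β² − d_K` (and the `W.conductorNorm` form under the record's conductor CLAIM `hN`);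
  `Record.lt_natAbs_discr_of_heegnerCheck : 4 < |d_K|`; the screen in the kernel's currency
  `Record.padicValNat_tamagawaProduct_le_indexVal_of_heegnerCheck : padicValNat p (∏_ℓ c_ℓ(W)) ≤ c.indexVal`
  (through `Record.tamagawaProduct_eq_of_tamCheck`).
* NOT checked (CLAIMS, two engines, display files `X9/PrintCertHeegnerCerts*.lean`): that `m_K` IS the Heegner index of
  the frame (engine S: Sage 10.9 `heegner_point_height` — Gross–Zagier with `at1`/`deriv_at1` error bounds — over the
  eclib-saturated Cremona generator; engine P: PARI 2.17 `ellL1`/`elltwist`/`omega` Gross–Zagier height over the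
  `ellheegner` point saturated by `ellsaturation`; both `m_K²` intervals pin the same integer), that `#Ш_an(E^D)` is the
  twist's analytic Ш (engine S exact `L_ratio`, engine P `ellL1`/`ellbsd`), `L(E^D,1) ≠ 0` (idem; ⇒ `y_K` of infinite
  order by Gross–Zagier), `h(D)`, `#E(K)_tors`, the conductor `N(W) = r.conductor`.
What the screen can and cannot do: J / J₃ say `∃ B, ∀ |d_K| > B, …`, so NO finite set of frames refutes them logically;
a frame with `v_p(m_K) < t` would contradict BSD for `E/K` itself (Jetchev Conj. 1.1) — none occurs; a frame with
`v_p(m_K) > t` exhibits `Ш(E/K)[p] ≠ 0` (from the twist), where `p^t ∣ y_K` holds with room to spare.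

References: B. H. Gross, D. Zagier, Invent. Math. 84 (1986) I (6.4), V (2.1)–(2.3) [GrossZagier1986]; D. Jetchev,
Compos. Math. 144 (2008) Conj. 1.1, Rem. 1.2, Thm. 1.4 [Jetchev2008]; B. H. Gross, in *L-functions and Arithmetic*
(1991) §1–§2 [GrossLMS1991]; D. A. Marcus, *Number Fields*, Ch. 3 Thm. 25 (decomposition law) [Marcus1977];
D. A. Cox, *Primes of the form x² + ny²* (2013) §1.C Lemma 1.14, §7.B [Cox2013]; J. E. Cremona, *Algorithms* (1997)
§3.4, Table 1 [CremonaAlgorithms1997].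
-/

set_option autoImplicit false

open scoped NumberField
open WeierstrassCurve
open Summit.BirchSwinnertonDyer.Rank1Residual.Additive
open Summit.BirchSwinnertonDyer.BirchSwinnertonDyer.Rank1Residual.IntModel (minimalDiscriminantInt_eq)
open Literature.NumberTheory.EllipticCurves (IsImaginaryQuadratic SatisfiesHeegnerHypothesis
  not_dvd_conductorNorm_of_hasGoodReductionAtPrime)
open Literature.NumberTheory.EllipticCurves.Rank1Residual.X11RankOneCertificates (discOf)

namespace Summit.BirchSwinnertonDyer.Rank1Residual.X9.PrintCert

/-- A HEEGNER FRAME CERTIFICATE of a rank-`1` record `(E, p)`: the frame `K = ℚ(√D)` and its Heegner-index data.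
Data only (see the module docstring for the meaning of each field and which fields are rechecked).
[cite: GrossZagier1986, V (2.1)–(2.3)] [cite: Jetchev2008, Conj. 1.1] -/
structure HeegnerCert where
  /-- Cremona label of the record's curve (key). -/
  label : String
  /-- the record's prime `p` (key). -/
  p : ℕ
  /-- the fundamental discriminant `d_K = D < 0` of the frame `K = ℚ(√D)`. -/
  D : ℤ
  /-- `β` with `4N ∣ β² − D`, `0 ≤ β ≤ 2N` (the frame binder of J / J₃). -/
  beta : ℕ
  /-- `r_p` with `p ∣ r_p² − D` (`p` splits in `K`). -/
  sqrtModP : ℕ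
  /-- the class number `h(D)` (documentation: the number of Heegner points of conductor `1` above each `β`). -/
  classNumber : ℕ
  /-- a-invariants of the minimal model of the twist `E^D`. -/
  twist : List ℤ
  /-- conductor of `E^D`. -/
  twistConductor : ℕ
  /-- `L(E^D, 1)/Ω(E^D) = (num, den)`, exact (engine S, Sage `L_ratio`), `num ≠ 0`. -/
  twistLRatio : ℤ × ℕ
  /-- `#E^D(ℚ)_tors`. -/
  twistTorsion : ℕ
  /-- `∏_q c_q(E^D)`. -/
  twistTamagawa : ℕ
  /-- `#Ш_an(E^D/ℚ)` (two engines). -/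
  twistSha : ℕ
  /-- the Tamagawa depth `t = ord_p ∏_ℓ c_ℓ(E)` of the record (rechecked against the record). -/
  depth : ℕ
  /-- the Heegner index `m_K = [E(K)_{/tors} : ℤ y_K]` of the frame (two engines, Gross–Zagier). -/
  index : ℕ
  /-- `v_p(m_K)`. -/
  indexVal : ℕ
  /-- `#E(K)_tors`. -/
  torsionK : ℕ
  /-- provenance strings (engines, kit jobs); documentation. -/
  engines : List String
  deriving DecidableEq, Repr

/-- `n` is squarefree, by trial division up to `√n` (for the small `|D|` of the frames). [folklore] -/
def sqfreeNat (n : ℕ) : Bool := (List.range (Nat.sqrt n + 1)).all fun k => decide (k < 2 ∨ n % (k * k) ≠ 0)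

/-- `D` is a (negative or positive) fundamental discriminant: `D ≡ 1 (mod 4)` squarefree, or `D = 4m` with
`m ≡ 2, 3 (mod 4)` squarefree. [cite: Cox2013, §7.B (p. 137)] -/
def isFundDisc (D : ℤ) : Bool :=
  (decide (D % 4 = 1) && sqfreeNat D.natAbs) ||
    (decide (D % 4 = 0) && decide (D / 4 % 4 = 2 ∨ D / 4 % 4 = 3) && sqfreeNat (D / 4).natAbs)

namespace Record

variable (r : Record)

/-- Keys: the certificate is about this record (label, prime), which has analytic rank `1`. [folklore] -/
def passHKeys (c : HeegnerCert) : Bool := (c.label == r.label) && (c.p == r.p) && (r.rank == 1)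

/-- The discriminant part: `D < 0` fundamental with `|D| > 4` (`u_K = 1`); `D ≡ 1 (mod 8)` whenever `p = 3` (J₃'s
rev-3b binder) or `2 ∣ N`; `gcd(D, N) = 1`; the frame binder `4N ∣ β² − D` with `β ≤ 2N` (`N` = the record's conductor).
[cite: GrossZagier1986, I §3] [cite: Cox2013, §7.B] -/
def passHDisc (c : HeegnerCert) : Bool :=
  decide (c.D < 0) && isFundDisc c.D && decide (4 < c.D.natAbs) &&
  decide (r.p = 3 ∨ r.conductor % 2 = 0 → c.D % 8 = 1) &&
  decide (Int.gcd c.D r.conductor = 1) && decide (((c.beta : ℤ) ^ 2 - c.D) % (4 * (r.conductor : ℤ)) = 0) &&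
  decide (c.beta ≤ 2 * r.conductor)

/-- The splitting witnesses: at every listed bad prime `q` (`q = 2`: `D ≡ 1 (mod 8)`; `q` odd: `q ∣ β² − D` and
`q ∤ D`) and at `p` (`p ∤ D`, `p ∣ r_p² − D`). [cite: Marcus1977, Ch. 3 Thm. 25] -/
def passHSplit (c : HeegnerCert) : Bool :=
  r.bad.all (fun t => if t.1 = 2 then decide (c.D % 8 = 1)
    else decide (((c.beta : ℤ) ^ 2 - c.D) % (t.1 : ℤ) = 0) && decide (c.D % (t.1 : ℤ) ≠ 0)) &&
  decide (c.D % (r.p : ℤ) ≠ 0) && decide (((c.sqrtModP : ℤ) ^ 2 - c.D) % (r.p : ℤ) = 0)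

/-- THE SCREEN and its coherence: `depth = ord_p(∏c)` (the record's), `0 < m_K`, `indexVal = v_p(m_K)`,
`ord_p(∏c) ≤ v_p(m_K)`; `0 < #Ш_an(E^D)` and the GZ–BSD identity `2·v_p(m_K) = 2·ord_p(∏c) + v_p(#Ш_an(E)·#Ш_an(E^D))`
(odd `p`). [cite: Jetchev2008, Conj. 1.1, Rem. 1.2] -/
def passHScreen (c : HeegnerCert) : Bool :=
  decide (c.depth = padicValNat r.p r.tamagawa) &&
  decide (0 < c.index) && decide (c.indexVal = padicValNat r.p c.index) &&
  decide (padicValNat r.p r.tamagawa ≤ c.indexVal) && decide (0 < c.twistSha) &&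
  decide (2 * c.indexVal = 2 * padicValNat r.p r.tamagawa + padicValNat r.p (r.shaAn * c.twistSha))

/-- The twist's BSD coherence `num · T² = #Ш_an(E^D) · ∏c(E^D) · den` for `L(E^D,1)/Ω = num/den ≠ 0` (as the rank-`0`
clause of `Record.passInvariants`), five a-invariants, provenance present. [folklore] -/
def passHTwist (c : HeegnerCert) : Bool :=
  decide (c.twistLRatio.1 ≠ 0) && decide (0 < c.twistLRatio.2) && decide (0 < c.twistTorsion) &&
  decide (c.twistLRatio.1 * (c.twistTorsion : ℤ) ^ 2 = (c.twistSha : ℤ) * c.twistTamagawa * c.twistLRatio.2) &&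
  decide (c.twist.length = 5) && !c.engines.isEmpty

/-- The KERNEL CHECK of a Heegner frame certificate against a record: keys, discriminant part, splitting witnesses,
the screen with its GZ–BSD coherence, the twist's BSD coherence (see the five parts above and the module docstring).
[cite: Jetchev2008, Conj. 1.1, Rem. 1.2] [cite: GrossZagier1986, V (2.2)] -/
def heegnerCheck (c : HeegnerCert) : Bool :=
  r.passHKeys c && r.passHDisc c && r.passHSplit c && r.passHScreen c && passHTwist c

variable {r}

/-- Projections of a passing Heegner check onto its five parts. [folklore] -/
theorem parts_of_heegnerCheck {c : HeegnerCert} (h : r.heegnerCheck c = true) :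
    r.passHKeys c = true ∧ r.passHDisc c = true ∧ r.passHSplit c = true ∧ r.passHScreen c = true ∧
      passHTwist c = true := by
  simp only [heegnerCheck, Bool.and_eq_true] at h
  exact ⟨h.1.1.1.1, h.1.1.1.2, h.1.1.2, h.1.2, h.2⟩

/-- Unpacking the keys: same prime, rank `1`. [folklore] -/
theorem keys_of_heegnerCheck {c : HeegnerCert} (h : r.heegnerCheck c = true) : c.p = r.p ∧ r.rank = 1 := by
  have h' := (parts_of_heegnerCheck h).1
  simp only [passHKeys, Bool.and_eq_true, beq_iff_eq] at h'
  exact ⟨h'.1.2, h'.2⟩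

/-- Unpacking the discriminant part. [folklore] -/
theorem disc_of_heegnerCheck {c : HeegnerCert} (h : r.heegnerCheck c = true) :
    c.D < 0 ∧ 4 < c.D.natAbs ∧ (r.p = 3 ∨ r.conductor % 2 = 0 → c.D % 8 = 1) ∧ Int.gcd c.D r.conductor = 1 ∧
      ((c.beta : ℤ) ^ 2 - c.D) % (4 * (r.conductor : ℤ)) = 0 := by
  have h' := (parts_of_heegnerCheck h).2.1
  simp only [passHDisc, Bool.and_eq_true, decide_eq_true_eq] at h'
  obtain ⟨⟨⟨⟨⟨⟨hD0, -⟩, hD4⟩, h8⟩, hgcd⟩, hβ⟩, -⟩ := h'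
  exact ⟨hD0, hD4, h8, hgcd, hβ⟩

/-- Unpacking the splitting witnesses. [folklore] -/
theorem split_of_heegnerCheck {c : HeegnerCert} (h : r.heegnerCheck c = true) :
    (∀ t ∈ r.bad, (if t.1 = 2 then decide (c.D % 8 = 1)
        else decide (((c.beta : ℤ) ^ 2 - c.D) % (t.1 : ℤ) = 0) && decide (c.D % (t.1 : ℤ) ≠ 0)) = true) ∧
      c.D % (r.p : ℤ) ≠ 0 ∧ ((c.sqrtModP : ℤ) ^ 2 - c.D) % (r.p : ℤ) = 0 := by
  have h' := (parts_of_heegnerCheck h).2.2.1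
  simp only [passHSplit, Bool.and_eq_true, decide_eq_true_eq, List.all_eq_true] at h'
  exact ⟨h'.1.1, h'.1.2, h'.2⟩

/-- Unpacking the screen. [folklore] -/
theorem screen_of_heegnerCheck {c : HeegnerCert} (h : r.heegnerCheck c = true) :
    0 < c.index ∧ c.indexVal = padicValNat r.p c.index ∧ padicValNat r.p r.tamagawa ≤ c.indexVal ∧
      2 * c.indexVal = 2 * padicValNat r.p r.tamagawa + padicValNat r.p (r.shaAn * c.twistSha) ∧
      c.depth = padicValNat r.p r.tamagawa := by
  have h' := (parts_of_heegnerCheck h).2.2.2.1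
  simp only [passHScreen, Bool.and_eq_true, decide_eq_true_eq] at h'
  obtain ⟨⟨⟨⟨⟨hd, h0⟩, hv⟩, hs⟩, -⟩, hcoh⟩ := h'
  exact ⟨h0, hv, hs, hcoh, hd⟩

/-! ### Soundness of the frame part: the decomposition law in `K` with `d_K = D` -/

/-- A square root of `D` modulo an odd prime `ℓ ∤ D` makes `(D/ℓ) = +1`: `legendreSym ℓ D = 1`.
[cite: Cox2013, §1.C Lemma 1.14] -/
theorem legendreSym_eq_one_of_sq_sub_emod {ℓ : ℕ} [Fact ℓ.Prime] {D s : ℤ} (hs : (s ^ 2 - D) % (ℓ : ℤ) = 0)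
    (hD : D % (ℓ : ℤ) ≠ 0) : legendreSym ℓ D = 1 := by
  have hD' : (D : ZMod ℓ) ≠ 0 := by
    rw [Ne, ZMod.intCast_zmod_eq_zero_iff_dvd]
    exact fun h => hD (Int.emod_eq_zero_of_dvd h)
  rw [legendreSym.eq_one_iff ℓ hD']
  refine ⟨(s : ZMod ℓ), ?_⟩
  have h0 : ((s ^ 2 - D : ℤ) : ZMod ℓ) = 0 :=
    (ZMod.intCast_zmod_eq_zero_iff_dvd _ ℓ).mpr (Int.dvd_of_emod_eq_zero hs)
  push_cast at h0
  linear_combination -h0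

section Frame

variable {K : Type} [Field K] [NumberField K]

/-- **An odd prime with a square root of `d_K` (and not dividing `d_K`) SPLITS in the quadratic field `K`.**
[cite: Marcus1977, Ch. 3 Thm. 25] -/
theorem ncard_primesOver_eq_two_of_witness (hK2 : Module.finrank ℚ K = 2) {ℓ : ℕ} (hℓ : ℓ.Prime) (hℓ2 : ℓ ≠ 2)
    {s : ℤ} (hs : (s ^ 2 - NumberField.discr K) % (ℓ : ℤ) = 0) (hD : NumberField.discr K % (ℓ : ℤ) ≠ 0) :
    ((Ideal.span {(ℓ : ℤ)}).primesOver (𝓞 K)).ncard = 2 := by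
  haveI := Fact.mk hℓ
  exact (Literature.NumberTheory.QuadraticFields.Quadratic.ncard_primesOver_eq_two_iff_legendreSym hK2 hℓ2).mpr
    (legendreSym_eq_one_of_sq_sub_emod hs hD)

/-- **`2` SPLITS in the quadratic field `K` when `d_K ≡ 1 (mod 8)`.** [cite: Marcus1977, Ch. 3 Thm. 25] -/
theorem ncard_primesOver_two_eq_two_of_mod_eight (hK2 : Module.finrank ℚ K = 2)
    (h8 : NumberField.discr K % 8 = 1) : ((Ideal.span {((2 : ℕ) : ℤ)}).primesOver (𝓞 K)).ncard = 2 := by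
  rw [Nat.cast_ofNat]
  exact (Literature.NumberTheory.QuadraticFields.Quadratic.ncard_primesOver_two_eq_two_iff hK2).mpr h8

variable {W : WeierstrassCurve ℚ} [W.IsElliptic] [W.IsGloballyMinimal] (hI : integralModelInt W = r.intCurve)
include hI

omit [W.IsElliptic] in
/-- A prime dividing the conductor of a globally minimal `W` with the record's integral model divides the record's
RECOMPUTED discriminant `Δ(ainvs)` (good reduction at `ℓ ∤ Δ_min` ⇒ `ℓ ∤ N`). [cite: SilvermanAEC2009, Prop. VII.5.1 (a)] -/
theorem dvd_discOf_of_dvd_conductorNorm [W.IsElliptic] (hc : r.check = true) {ℓ : ℕ} (hℓ : ℓ.Prime)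
    (hℓN : ℓ ∣ W.conductorNorm ℤ) : (ℓ : ℤ) ∣ discOf r.ainvs := by
  haveI := Fact.mk hℓ
  by_contra hΔ
  refine not_dvd_conductorNorm_of_hasGoodReductionAtPrime W ?_ hℓN
  refine hasGoodReductionAtPrime_of_not_dvd W ℓ ?_
  rw [minimalDiscriminantInt_eq hI, r.intCurve_Δ_eq hc]
  exact hΔ

/-- **SOUNDNESS (Heegner hypothesis for `N(W)`).** After a passing record recheck and a passing Heegner check, every
prime `ℓ ∣ N(W)` SPLITS in any quadratic number field `K` with `d_K = D`: `ℓ` is bad, hence listed in `bad`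
(`|Δ| = ∏ q^{v_q}` was rechecked), hence has the listed splitting witness (`ℓ = 2`: `D ≡ 1 (8)`; `ℓ` odd: `β² ≡ D`,
`ℓ ∤ D`), hence splits by the decomposition law. This is the frame binder
`SatisfiesHeegnerHypothesis (W.conductorNorm ℤ) K` of items 20392 / 21340 for the certificate's `K`.
[cite: GrossLMS1991, §1 (p. 235)] [cite: Marcus1977, Ch. 3 Thm. 25] -/
theorem satisfiesHeegnerHypothesis_of_heegnerCheck (hc : r.check = true) {c : HeegnerCert}
    (hh : r.heegnerCheck c = true) (hK2 : Module.finrank ℚ K = 2) (hd : NumberField.discr K = c.D) :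
    SatisfiesHeegnerHypothesis (W.conductorNorm ℤ) K := by
  intro ℓ hℓ hℓN
  obtain ⟨t, ht, rfl⟩ := r.exists_mem_bad_of_prime_dvd hc hℓ (dvd_discOf_of_dvd_conductorNorm hI hc hℓ hℓN)
  have hw := (split_of_heegnerCheck hh).1 t ht
  by_cases h2 : t.1 = 2
  · rw [if_pos h2, decide_eq_true_eq] at hw
    rw [h2]
    exact ncard_primesOver_two_eq_two_of_mod_eight hK2 (hd ▸ hw)
  · rw [if_neg h2, Bool.and_eq_true, decide_eq_true_eq, decide_eq_true_eq] at hw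
    exact ncard_primesOver_eq_two_of_witness hK2 hℓ h2 (hd ▸ hw.1) (hd ▸ hw.2)

omit [W.IsElliptic] [W.IsGloballyMinimal] hI in
/-- **SOUNDNESS (`p` split).** After a passing recheck (`p ∈ {3, 5, 7}`) and Heegner check (`p ∤ D`, `r_p² ≡ D`), the
record's prime splits in any quadratic `K` with `d_K = D`: the frame binder `SatisfiesHeegnerHypothesis p K` (free
prime `q = r.p`). [cite: Marcus1977, Ch. 3 Thm. 25] -/
theorem satisfiesHeegnerHypothesis_prime_of_heegnerCheck (hc : r.check = true) {c : HeegnerCert}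
    (hh : r.heegnerCheck c = true) (hK2 : Module.finrank ℚ K = 2) (hd : NumberField.discr K = c.D)
    {q : ℕ} (hq : q = r.p) : SatisfiesHeegnerHypothesis q K := by
  intro ℓ hℓ hℓq
  subst hq
  have hp : r.p.Prime := by rcases r.p_mem_of_check hc with h | h | h <;> rw [h] <;> norm_num
  have hℓp : ℓ = r.p := (Nat.prime_dvd_prime_iff_eq hℓ hp).mp hℓq
  subst hℓp
  have hℓ2 : r.p ≠ 2 := by rcases r.p_mem_of_check hc with h | h | h <;> rw [h] <;> norm_num
  obtain ⟨-, hpD, hrp⟩ := split_of_heegnerCheck hh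
  exact ncard_primesOver_eq_two_of_witness hK2 hℓ hℓ2 (hd ▸ hrp) (hd ▸ hpD)

omit [W.IsElliptic] [W.IsGloballyMinimal] hI in
/-- **SOUNDNESS (`2` split, J₃'s rev-3b binder).** At `p = 3` a passing Heegner check has `D ≡ 1 (mod 8)`, i.e.
`NumberField.discr K % 8 = 1` for any `K` with `d_K = D`. [cite: Marcus1977, Ch. 3 Thm. 25] -/
theorem discr_mod_eight_of_heegnerCheck {c : HeegnerCert} (hh : r.heegnerCheck c = true) (hp3 : r.p = 3)
    (hd : NumberField.discr K = c.D) : NumberField.discr K % 8 = 1 := by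
  rw [hd]; exact (disc_of_heegnerCheck hh).2.2.1 (Or.inl hp3)

omit [W.IsElliptic] [W.IsGloballyMinimal] hI in
/-- **SOUNDNESS (`|d_K| > 4`, so `u_K = 1`).** [cite: GrossZagier1986, I §3] -/
theorem lt_natAbs_discr_of_heegnerCheck {c : HeegnerCert} (hh : r.heegnerCheck c = true)
    (hd : NumberField.discr K = c.D) : 4 < (NumberField.discr K).natAbs := by
  rw [hd]; exact (disc_of_heegnerCheck hh).2.1

omit [W.IsElliptic] [W.IsGloballyMinimal] hI in
/-- **SOUNDNESS (the frame binder `4N ∣ β² − d_K`, record's conductor).** [cite: GrossZagier1986, I §3] -/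
theorem dvd_beta_sq_sub_discr_of_heegnerCheck {c : HeegnerCert} (hh : r.heegnerCheck c = true)
    (hd : NumberField.discr K = c.D) : (4 * (r.conductor : ℤ)) ∣ (c.beta : ℤ) ^ 2 - NumberField.discr K := by
  rw [hd]; exact Int.dvd_of_emod_eq_zero (disc_of_heegnerCheck hh).2.2.2.2

omit [W.IsElliptic] [W.IsGloballyMinimal] hI in
/-- The frame binder in the route's currency `(4 * (W.conductorNorm ℤ : ℤ)) ∣ β ^ 2 - NumberField.discr K`, under the
record's conductor CLAIM `N(W) = r.conductor` (not rechecked by the kernel). [cite: GrossZagier1986, I §3] -/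
theorem dvd_beta_sq_sub_discr_of_heegnerCheck_of_conductor {c : HeegnerCert} (hh : r.heegnerCheck c = true)
    (hd : NumberField.discr K = c.D) (hN : W.conductorNorm ℤ = r.conductor) :
    (4 * (W.conductorNorm ℤ : ℤ)) ∣ (c.beta : ℤ) ^ 2 - NumberField.discr K := by
  rw [hN]; exact dvd_beta_sq_sub_discr_of_heegnerCheck hh hd

/-- **THE FRAME, packaged**: for any imaginary quadratic `K` with `d_K = D` and any globally minimal `W` with the
record's integral model, the certificate's `K` satisfies every frame binder of J (item 20392) — and of J₃ (item 21340)
when `p = 3` — except the size bound `B < |d_K|` (`B` is the crux's own existential; here `|d_K| > 4`).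
[cite: GrossLMS1991, §1 (p. 235)] [cite: Jetchev2008, §1] -/
theorem frame_of_heegnerCheck (hc : r.check = true) {c : HeegnerCert} (hh : r.heegnerCheck c = true)
    (hK : IsImaginaryQuadratic K) (hd : NumberField.discr K = c.D) {q : ℕ} (hq : q = r.p) :
    SatisfiesHeegnerHypothesis (W.conductorNorm ℤ) K ∧ SatisfiesHeegnerHypothesis q K ∧
      4 < (NumberField.discr K).natAbs ∧ (4 * (r.conductor : ℤ)) ∣ (c.beta : ℤ) ^ 2 - NumberField.discr K ∧
      (q = 3 → NumberField.discr K % 8 = 1) :=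
  ⟨satisfiesHeegnerHypothesis_of_heegnerCheck hI hc hh hK.1 hd,
    satisfiesHeegnerHypothesis_prime_of_heegnerCheck hc hh hK.1 hd hq, lt_natAbs_discr_of_heegnerCheck hh hd,
    dvd_beta_sq_sub_discr_of_heegnerCheck hh hd, fun h3 => discr_mod_eight_of_heegnerCheck hh (hq ▸ h3) hd⟩

/-! ### The screen in the kernel's currency -/

omit [W.IsElliptic] in
/-- **THE SCREEN**: after a passing Heegner check and a passing Tamagawa row certificate, the kernel Tamagawa depth of
`W` is at most the certificate's index valuation: `ord_p ∏_ℓ c_ℓ(W) ≤ v_p(m_K)` — the `n = 1`, `s = t` demand of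
J / J₃ (`p^t ∣ y_K`) holds on this frame GRANTED the two-engine claim that `m_K` is the frame's Heegner index.
[cite: Jetchev2008, Conj. 1.1, Thm. 1.4] -/
theorem padicValNat_tamagawaProduct_le_indexVal_of_heegnerCheck {c : HeegnerCert} (hh : r.heegnerCheck c = true)
    {tc : TamCert} (htc : r.tamCheck tc = true) {q : ℕ} (hq : q = r.p) :
    padicValNat q W.tamagawaProduct ≤ c.indexVal := by
  rw [hq, Record.tamagawaProduct_eq_of_tamCheck hI htc]; exact (screen_of_heegnerCheck hh).2.2.1

omit [W.IsElliptic] in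
/-- **GZ–BSD coherence in the kernel's currency**: `2·v_p(m_K) = 2·ord_p ∏_ℓ c_ℓ(W) + v_p(#Ш_an(E)·#Ш_an(E^D))` with the
record's `#Ш_an(E)` and the certificate's `#Ш_an(E^D)` (claims) — Jetchev's Conj. 1.1 read `p`-adically on the frame.
[cite: Jetchev2008, Conj. 1.1, Rem. 1.2] -/
theorem two_mul_indexVal_eq_of_heegnerCheck {c : HeegnerCert} (hh : r.heegnerCheck c = true)
    {tc : TamCert} (htc : r.tamCheck tc = true) {q : ℕ} (hq : q = r.p) :
    2 * c.indexVal = 2 * padicValNat q W.tamagawaProduct + padicValNat q (r.shaAn * c.twistSha) := by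
  rw [hq, Record.tamagawaProduct_eq_of_tamCheck hI htc]; exact (screen_of_heegnerCheck hh).2.2.2.1

end Frame

end Record

/-! ### Lookup over a display list of certificates -/

/-- Every rank-`1` record of `rs` selected by `live` has a certificate in `cs` passing `Record.heegnerCheck` (one Boolean,
evaluated by `decide` in the display files `X9/PrintCertHeegnerCerts*.lean`). [folklore] -/
def heegnerScreen (rs : List Record) (live : Record → Bool) (cs : List HeegnerCert) : Bool :=
  rs.all fun r => !(live r) || cs.any fun c => r.heegnerCheck c

/-- Unpacking a passing screen: a selected record has a passing certificate in the list. [folklore] -/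
theorem exists_heegnerCheck_of_heegnerScreen {rs : List Record} {live : Record → Bool} {cs : List HeegnerCert}
    (h : heegnerScreen rs live cs = true) {r : Record} (hr : r ∈ rs) (hl : live r = true) :
    ∃ c ∈ cs, r.heegnerCheck c = true := by
  simp only [heegnerScreen, List.all_eq_true, Bool.or_eq_true, Bool.not_eq_true', List.any_eq_true] at h
  rcases h r hr with h | h
  · rw [hl] at h; exact absurd h (by decide)
  · exact h

/-- The J-live selector of leaf X9: analytic rank `1` and `p ∣ ∏ c_ℓ` (crux J load-bearing). [folklore] -/
def liveX9 (r : Record) : Bool := (r.rank == 1) && decide (r.p ∣ r.tamagawa)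

/-- The J₃-live selector of leaf X10b: analytic rank `1` (all 39 such records have `3 ∣ ∏ c_ℓ`). [folklore] -/
def liveX10b (r : Record) : Bool := r.rank == 1

/-! ### Kernel self-test: `37510l1 @ 3` (leaf X10b, `t = 2`, frame `ℚ(√−239)`) — filled in by the data files; here the
schema's shape is exercised on a synthetic certificate against the schema's sample record. -/

end Summit.BirchSwinnertonDyer.Rank1Residual.X9.PrintCert
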